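import Summits.BirchSwinnertonDyer.BirchSwinnertonDyer.Theorems.ByReductionTypeAtTwoOrdKatoHalfAtTwoIsoHintOfAbbesUllmo
import Summits.BirchSwinnertonDyer.Rank1Residual.X5.KatoOrdTwoMuPart
import Literature.NumberTheory.EllipticCurves.NonEisensteinPrimeOfSurjective
import Literature.NumberTheory.EllipticCurves.IsogenyIdProofs
import Literature.Uncategorized.OrdPublishedInputsAtTwo
import Literature.NumberTheory.EllipticCurves.Greenberg1999.TwoTorsionMuInvariant
import HarnessLib

/-!
# Cert46a — crux-triage r1 seat 1/2, GEN 46 (refuter; crux `OrdKatoHalfAtTwoIso`, stmt-BirchSwinnertonDyer-19573)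
# PRE-VET BY TYPE of the LEAD g10's announced v24 (ii) stub text «G11⁺» (INBOX l.2277, 2026-08-29T16:08Z),
# ROUTE-FILE-FREE variant (the K4 `Theses.ByReductionTypeAtTwo` cone answers rc 75 on the farm since ≤ 15:41Z,
# STATUS l.3886 / probe P46a rc 75 `remote:stale:…:lag:…Theses.GenusKolyvaginAtTwo`): nothing below imports the route file.

HONEST FRAMING. Evidence for a triage verdict, NOT a Theorems landing, NOT a proof of anything open: BSD is not proved,
crux 202 is not proved, G11⁺ (= Greenberg LNM 1716 Conj. 1.11 at `p = 2` on the cell [non-CM · r_an = 0 · good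
ordinary at 2 · ρ̄₂ onto · 0 < Δ], p. 64) is an OPEN published conjecture displayed as a HYPOTHESIS. What the kernel
certifies here: the «3-line direct road» the LEAD named — G11⁺ + Abbes–Ullmo (print) + Kato 17.4 (1)(2) at 2 (print,
PUB's third conjunct) ⟹ the TEXT of the crux's `0 < Δ` conjunct `OrdKatoHalfAtTwoIsoPosDisc` (p693557 :149,
restated verbatim as `PosDiscText` to stay off the stale cone) with `W' := W` — i.e. the v24 (ii) re-cut
{`stub_muFreeValue_posDisc_two` (V♭⁺, memo) + `stub_conjA_two_posDisc` (Q⁺, research)} ↦ ONE stub G11⁺ keeps the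
`0 < Δ` slot of `OrdKatoHalfAtTwoIso_of` CLOSED over {G11⁺, bundle} through LANDED doors only
(`O1.katoMuPartAtTwo_of_mu_eq_zero`, `O1.mainConjectureLowerDivisibilityAtTwoOrd_of_katoMuPartAtTwo`,
`hint_two_of_abbesUllmo_of_irr` p654400, `hasIrreducibleModPGaloisRep_of_hasSurjectiveModNGaloisRep`, `isIsogenous_self`).
The converse (crux ⟹ G11⁺ mod PUB + Cassels + AU) is the landed NECESSITY I `mu_eq_zero_of_posDisc` (p702303) — its
conclusion has EXACTLY G11⁺'s matrix (checked by `Iff.rfl`-shape in Cert46b once the cone builds).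
-/

set_option autoImplicit false
set_option linter.dupNamespace false

noncomputable section

open scoped Classical MatrixGroups ModularForm
open CongruenceSubgroup WeierstrassCurve Field
open Literature.NumberTheory.GaloisRepresentations
open Literature.NumberTheory.EllipticCurves Literature.NumberTheory.EllipticCurves.ModularForms
open Literature.NumberTheory.EllipticCurves.Rank1Residual
open Summit.BirchSwinnertonDyer.Rank1Residual Summit.BirchSwinnertonDyer.Rank1Residual.X5
open Summit.BirchSwinnertonDyer.BirchSwinnertonDyer.Theorems.SteinbergFibreAtTwo

namespace Summit.BirchSwinnertonDyer.BirchSwinnertonDyer.Cruxes.OrdKatoHalfAtTwoIso.TriageCert46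

/-- **G11⁺ VERBATIM as the LEAD g10 typed it** (INBOX l.2277): Greenberg Conj. 1.11 at `p = 2` on the cell, for every
cyclotomic normalised dual datum — no cotorsion binder (cotorsion = Kato 17.4 (1) at 2 = PUB, taken inside glue).
`D.mu` is choice-free: `SelmerDualData` pins `X` up to unique `Λ`-iso (`toDual` bijective + the two action identities),
so the text is NOT junk-falsifiable by a rogue datum. Displayed as a hypothesis; nothing asserted.
[cite: GreenbergLNM1716, Conj. 1.11 (p. 64)] -/
def GreenbergConj111TwoOrdOntoPosDisc : Prop :=
  ∀ (W : WeierstrassCurve ℚ) [W.IsElliptic] [W.IsGloballyMinimal], ¬ W.HasCM → W.analyticRank = 0 → GoodOrd W 2 →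
    W.HasSurjectiveModNGaloisRep 2 → 0 < W.Δ → ∀ (κ : ZpExtension ℚ 2) (γ : absoluteGaloisGroup ℚ),
      κ.IsCyclotomic → κ.IsTopGenerator γ → IsCyclotomicVariable 2 γ → ∀ D : W.SelmerDualData κ γ, D.mu = 0

/-- The crux's `0 < Δ` conjunct — VERBATIM the body of `Theorems.SteinbergFibreAtTwo.OrdKatoHalfAtTwoIsoPosDisc`
(…OrdKatoHalfAtTwoIsoPosDiscDefs.lean :149–153), restated to avoid the stale route-file cone. -/
def PosDiscText : Prop :=
  ∀ (W : WeierstrassCurve ℚ) [W.IsElliptic] [W.IsGloballyMinimal], ¬ W.HasCM → W.analyticRank = 0 →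
    Literature.NumberTheory.EllipticCurves.Rank1Residual.GoodOrd W 2 → W.HasSurjectiveModNGaloisRep 2 → 0 < W.Δ →
    ∃ (W' : WeierstrassCurve ℚ) (_ : W'.IsElliptic) (_ : W'.IsGloballyMinimal),
      WeierstrassCurve.IsIsogenous W W' ∧
        Summit.BirchSwinnertonDyer.Rank1Residual.X5.O1.MainConjectureLowerDivisibilityAtTwoOrd W'

/-- LINE 1 of the direct road: **G11⁺ ⇒ Kato's `μ`-part `O1.KatoMuPartAtTwo W` at every curve of the cell**
(`O1.katoMuPartAtTwo_of_mu_eq_zero`: `2^0 ∣ L₀`). [cite: GreenbergLNM1716, Conj. 1.11 (p. 64) (shape)] -/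
theorem katoMuPartAtTwo_of_g11 (hG : GreenbergConj111TwoOrdOntoPosDisc) (W : WeierstrassCurve ℚ) [W.IsElliptic]
    [W.IsGloballyMinimal] (hcm : ¬ W.HasCM) (hr : W.analyticRank = 0) (hgo : GoodOrd W 2)
    (h2 : W.HasSurjectiveModNGaloisRep 2) (hΔ : 0 < W.Δ) : O1.KatoMuPartAtTwo W :=
  O1.katoMuPartAtTwo_of_mu_eq_zero W (hG W hcm hr hgo h2 hΔ)

/-- LINE 2: **+ Abbes–Ullmo BY NAME (the `hint` currency at 2 on the irreducible good-ordinary locus, p654400's road)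
+ Kato 17.4 (1)(2) AT `W` ⇒ the integral lower divisibility `O1.MainConjectureLowerDivisibilityAtTwoOrd W` AT `W`.**
[cite: Kato2004Asterisque, Thm. 17.4 (1)(2) (p. 273)] [cite: AbbesUllmo1996, Thm. A] -/
theorem mainConjectureLowerDivisibilityAtTwoOrd_of_g11 (hG : GreenbergConj111TwoOrdOntoPosDisc)
    (hAU : abbesUllmo_not_dvd_maninConstant_of_not_dvd_level) (W : WeierstrassCurve ℚ) [W.IsElliptic]
    [W.IsGloballyMinimal] (hcm : ¬ W.HasCM) (hr : W.analyticRank = 0) (hgo : GoodOrd W 2)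
    (h2 : W.HasSurjectiveModNGaloisRep 2) (hΔ : 0 < W.Δ)
    (h17 : ∀ [NeZero (W.conductorNorm ℤ)] (f : CuspForm (Gamma0 (W.conductorNorm ℤ)) 2),
      kato_divisibility_allPrimes W 2 (f := f)) :
    O1.MainConjectureLowerDivisibilityAtTwoOrd W := by
  haveI : NeZero ((2 : ℕ) : ℚ) := ⟨by norm_num⟩
  exact O1.mainConjectureLowerDivisibilityAtTwoOrd_of_katoMuPartAtTwo W h17
    (fun f hf ϖ hϖ => hint_two_of_abbesUllmo_of_irr hAU W hgo
      (hasIrreducibleModPGaloisRep_of_hasSurjectiveModNGaloisRep W 2 h2) f hf ϖ hϖ)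
    (katoMuPartAtTwo_of_g11 hG W hcm hr hgo h2 hΔ)

/-- LINE 3: **the `0 < Δ` conjunct's TEXT with `W' := W`** — the v24 (ii) replacement of v23's `posDisc_of_stubs`
(`ordKatoHalfAtTwoIsoPosDisc_of_epsilon P⁺ Q⁺ AU h17`) by «G11⁺, AU, h17». [cite: Kato2004Asterisque, Thm. 17.4 (1)(2) (p. 273)] -/
theorem posDiscText_of_g11 (hG : GreenbergConj111TwoOrdOntoPosDisc)
    (hAU : abbesUllmo_not_dvd_maninConstant_of_not_dvd_level)
    (h17 : ∀ (V : WeierstrassCurve ℚ) [V.IsElliptic] [V.IsGloballyMinimal] [NeZero (V.conductorNorm ℤ)]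
      (f : CuspForm (Gamma0 (V.conductorNorm ℤ)) 2), kato_divisibility_allPrimes V 2 (f := f)) :
    PosDiscText :=
  fun W _ _ hcm hr hgo h2 hΔ =>
    ⟨W, ‹_›, ‹_›, isIsogenous_self W,
      mainConjectureLowerDivisibilityAtTwoOrd_of_g11 hG hAU W hcm hr hgo h2 hΔ (h17 W)⟩

/-- The same with the print tier taken from the line's `stub_bundle` text (child 23889: PUB ∧ AU ∧ Greenberg 5.14@2;
Kato 17.4 (1)(2) at 2 = PUB's third conjunct; 5.14@2 idle here as in v19–v23). -/
theorem posDiscText_of_g11_bundle (hG : GreenbergConj111TwoOrdOntoPosDisc)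
    (hbundle : Literature.Uncategorized.OrdPublishedInputsAtTwo ∧
      abbesUllmo_not_dvd_maninConstant_of_not_dvd_level ∧
        Literature.NumberTheory.EllipticCurves.Greenberg1999.prop514_isTorsion_mu_eq_zero_two) :
    PosDiscText := by
  obtain ⟨hPub, hAU, -⟩ := hbundle
  obtain ⟨_, _, h17, _⟩ := hPub
  exact posDiscText_of_g11 hG hAU h17

end Summit.BirchSwinnertonDyer.BirchSwinnertonDyer.Cruxes.OrdKatoHalfAtTwoIso.TriageCert46

end
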